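import Summits.NavierStokesRegularity.FunctionalMining.TrigPolyExactCalculus
import Summits.NavierStokesRegularity.FunctionalMining.NoGo.MiddleEigenvalueKit
import Summits.NavierStokesRegularity.FunctionalMining.PressureFunctional
import Literature.Analysis.FluidPDE.TorusVorticityTensorTransport
import HarnessLib

/-!
# FunctionalMining — the planar witness `w` (planar shadow, part 2): a smooth divergence-free zero-mean
# field on `T³` with `λ₂(S) ≡ 0`, `σ ≡ 0`, and its pressure, all by exact Fourier tables

Search for candidate a priori estimates; no regularity claim. Cell `pub-nsfunc`, prove seat
(gen 18). Nothing about Navier–Stokes dynamics: one explicit trigonometric field and its pointwise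
kinematics, every identity read off the COMPUTABLE tables of `TrigPolyExact` (by `decide`).

THE FIELD. `w(x) = (−2 sin 4πx₂ − sin 2π(x₀+x₂), 0, sin 2πx₀ + sin 2π(x₀+x₂)) = (∂₂ψ, 0, −∂₀ψ)/(2π)`,
`ψ = cos 2πx₀ + cos 4πx₂ + cos 2π(x₀+x₂)` — a PLANAR field (second component zero, independent of
`x₁`; three stream-function modes `(1,0,0), (0,0,2), (1,0,1)`, the minimal support without a
sign-reversing isometry; the `(ℝ/2πℤ)³`-analogue of SIEVEK §6's field `P2D`). Component tables:
`W 0 = symm (0,0,2) i ++ symm (1,0,1) (i/2)`, `W 1 = []`, `W 2 = symm (1,0,0) (−i/2) ++ symm (1,0,1) (−i/2)`.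

PROVED HERE: `w = tabField W` is smooth, divergence free, zero-mean; `(∂ᵢw)ⱼ = 2π·evalR (D i (W j))`,
`(∂ₖ∂ᵢw)ⱼ = (2π)²·evalR (D k (D i (W j)))`; the strain matrix is symmetric, trace free and SINGULAR
(`det ≡ 0`: its table collects to `[]`), hence **`λ₂(S(w)) = 0` everywhere** (`middle_w_nonpos`; the
C3b multiplier `‖λ₂⁺‖_∞` vanishes); **`σ(w) ≡ 0`** (`stretchingDensity_w`; the C3a multiplier
`‖α⁺‖_∞` vanishes); `tr(∇w)² = (2π)²·evalR Q` and the zero-mean pressure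
**`π_w = pressureOf w = evalR P`**, `P = linv (neg Q)` (`pressureOf_w`), with
`∂ᵢ∂ⱼπ_w = (2π)²·evalR (D i (D j P))`.
-/

noncomputable section

open MeasureTheory Complex UnitAddTorus

namespace Summit.NavierStokesRegularity.FunctionalMining

open Literature.Analysis Literature.Analysis.FunctionSpaces Literature.Analysis.FunctionSpaces.Torus
  Literature.Analysis.FluidPDE
open TrigPolyExact TrigPolyExact.TP

namespace PlanarShadow

/-! ## 1. Vector fields from three tables -/

/-- The vector field with coordinate functions `evalR (T j)`. [ours; bookkeeping] -/
def tabField (T : Fin 3 → TP) (x : UnitAddTorus (Fin 3)) : EuclideanSpace ℝ (Fin 3) :=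
  evalR (T 0) x • EuclideanSpace.single 0 (1 : ℝ) + evalR (T 1) x • EuclideanSpace.single 1 (1 : ℝ) +
    evalR (T 2) x • EuclideanSpace.single 2 (1 : ℝ)

/-- Coordinates of `tabField`. [ours; bookkeeping] -/
@[simp] theorem tabField_apply (T : Fin 3 → TP) (x : UnitAddTorus (Fin 3)) (j : Fin 3) :
    tabField T x j = evalR (T j) x := by
  fin_cases j <;> simp [tabField]

/-- `tabField T` is smooth. [ours; bookkeeping] -/
theorem isSmooth_tabField (T : Fin 3 → TP) : IsSmooth (tabField T) :=
  (((isSmooth_evalR (T 0)).smul' (isSmooth_const _)).add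
    ((isSmooth_evalR (T 1)).smul' (isSmooth_const _))).add ((isSmooth_evalR (T 2)).smul' (isSmooth_const _))

/-- **Partial derivatives of a table field**: `∂ᵢ (tabField T) = 2π · tabField (D i ∘ T)`. [ours] -/
theorem partialDeriv_tabField (T : Fin 3 → TP) (i : Fin 3) :
    Torus.partialDeriv i (tabField T) = fun x => (2 * Real.pi) • tabField (fun j => TP.D i (T j)) x := by
  funext x
  have hc : IsContDiff 1 (tabField T) := (isSmooth_tabField T).isContDiff (by simp)
  ext j
  rw [← partialDeriv_apply_coord hc i x j]
  have : (fun y => tabField T y j) = evalR (T j) := funext fun y => tabField_apply T y j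
  rw [this, partialDeriv_evalR]
  simp

/-! ## 2. The witness -/

/-- Table of `w₀ = −2 sin 4πx₂ − sin 2π(x₀+x₂)`. [ours; bookkeeping] -/
def W0 : TP := symm (0, 0, 2) ⟨0, 1⟩ ++ symm (1, 0, 1) ⟨0, 1 / 2⟩

/-- Table of `w₂ = sin 2πx₀ + sin 2π(x₀+x₂)`. [ours; bookkeeping] -/
def W2 : TP := symm (1, 0, 0) ⟨0, -1 / 2⟩ ++ symm (1, 0, 1) ⟨0, -1 / 2⟩

/-- The component tables `(W 0, W 1, W 2) = (W0, [], W2)`. [ours; bookkeeping] -/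
def W : Fin 3 → TP := ![W0, [], W2]

/-- `W 0 = W0`. [ours; bookkeeping] -/
@[simp] theorem W_zero : W 0 = W0 := rfl
/-- `W 1 = []`. [ours; bookkeeping] -/
@[simp] theorem W_one : W 1 = [] := rfl
/-- `W 2 = W2`. [ours; bookkeeping] -/
@[simp] theorem W_two : W 2 = W2 := rfl

/-- The component tables are real. [ours; bookkeeping] -/
theorem isReal_W (j : Fin 3) : IsReal (W j) := by
  fin_cases j
  · exact (isReal_symm _ _).append (isReal_symm _ _)
  · exact isReal_nil
  · exact (isReal_symm _ _).append (isReal_symm _ _)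

/-- **The planar witness** `w = (evalR W0, 0, evalR W2)`. Search for candidate a priori estimates;
no regularity claim. [ours] -/
def w : UnitAddTorus (Fin 3) → EuclideanSpace ℝ (Fin 3) := tabField W

/-- Coordinates of `w`. [ours; bookkeeping] -/
theorem w_apply (x : UnitAddTorus (Fin 3)) (j : Fin 3) : w x j = evalR (W j) x := tabField_apply W x j

/-- `w` is smooth. [ours] -/
theorem isSmooth_w : IsSmooth w := isSmooth_tabField W

/-- `w` is `C¹`. [ours; bookkeeping] -/
theorem isContDiff_w : IsContDiff 1 w := isSmooth_w.isContDiff (by simp)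

/-- **Velocity gradient**: `(∂ᵢw)ⱼ(x) = 2π · evalR (D i (W j)) x`. [ours] -/
theorem partialDeriv_w (i : Fin 3) (x : UnitAddTorus (Fin 3)) (j : Fin 3) :
    Torus.partialDeriv i w x j = 2 * Real.pi * evalR (TP.D i (W j)) x := by
  rw [w, partialDeriv_tabField]; simp

/-- **Second derivatives**: `(∂ₖ∂ᵢw)ⱼ(x) = (2π)² · evalR (D k (D i (W j))) x`. [ours] -/
theorem partialDeriv_partialDeriv_w (k i : Fin 3) (x : UnitAddTorus (Fin 3)) (j : Fin 3) :
    Torus.partialDeriv k (Torus.partialDeriv i w) x j =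
      (2 * Real.pi) ^ 2 * evalR (TP.D k (TP.D i (W j))) x := by
  rw [w, partialDeriv_tabField]
  have h : (fun x => (2 * Real.pi) • tabField (fun j => TP.D i (W j)) x) =
      (2 * Real.pi) • tabField (fun j => TP.D i (W j)) := rfl
  rw [h, partialDeriv_const_smul ((isSmooth_tabField _).isContDiff (by simp)), partialDeriv_tabField]
  simp; ring

/-- Atoms are real: `eval (D i (W j)) = evalR (D i (W j))`. [ours; bookkeeping] -/
theorem eval_DW (i j : Fin 3) (x : UnitAddTorus (Fin 3)) :
    eval (TP.D i (W j)) x = ((evalR (TP.D i (W j)) x : ℝ) : ℂ) := ((isReal_W j).D i).eval_eq x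

/-- Atoms are real: `eval (D k (D i (W j))) = evalR (…)`. [ours; bookkeeping] -/
theorem eval_DDW (k i j : Fin 3) (x : UnitAddTorus (Fin 3)) :
    eval (TP.D k (TP.D i (W j))) x = ((evalR (TP.D k (TP.D i (W j))) x : ℝ) : ℂ) :=
  (((isReal_W j).D i).D k).eval_eq x

/-- Atoms are real: `eval (W j) = evalR (W j)`. [ours; bookkeeping] -/
theorem eval_W (j : Fin 3) (x : UnitAddTorus (Fin 3)) :
    eval (W j) x = ((evalR (W j) x : ℝ) : ℂ) := (isReal_W j).eval_eq x

/-! ## 3. Divergence free, zero mean -/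

/-- Table of `div w / (2π)`. [ours; bookkeeping] -/
def divT : TP := sum3 fun i => TP.D i (W i)

/-- The divergence table collects to the empty table. [ours; by `decide`] -/
theorem collect_divT : collect divT = [] := by decide +kernel

/-- **`w` is divergence free.** [ours] -/
theorem isDivFree_w : IsDivFree w := by
  intro x
  rw [divergence_eq_sum_partialDeriv_apply isContDiff_w, Fin.sum_univ_three, partialDeriv_w,
    partialDeriv_w, partialDeriv_w]
  have h : evalR divT x = 0 := by
    rw [← evalR_collect, collect_divT]; simp [evalR]
  simp only [divT, evalR, eval_sum3, Complex.add_re] at h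
  simp only [evalR]
  linear_combination (2 * Real.pi) * h

/-- Zero modes of the component tables vanish. [ours; by `decide`] -/
theorem coeff0_W (j : Fin 3) : coeff0 (W j) = GQ.zero := by
  fin_cases j <;> decide +kernel

/-- **`w` has zero mean.** [ours] -/
theorem hasZeroMean_w : HasZeroMean w := by
  show ∫ x, w x = 0
  have i0 : Integrable (fun x => evalR (W 0) x • EuclideanSpace.single (0 : Fin 3) (1 : ℝ)) :=
    ((isSmooth_evalR _).continuous.smul continuous_const).integrable_unitAddTorus
  have i1 : Integrable (fun x => evalR (W 1) x • EuclideanSpace.single (1 : Fin 3) (1 : ℝ)) :=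
    ((isSmooth_evalR _).continuous.smul continuous_const).integrable_unitAddTorus
  have i2 : Integrable (fun x => evalR (W 2) x • EuclideanSpace.single (2 : Fin 3) (1 : ℝ)) :=
    ((isSmooth_evalR _).continuous.smul continuous_const).integrable_unitAddTorus
  have i01 : Integrable (fun x => evalR (W 0) x • EuclideanSpace.single (0 : Fin 3) (1 : ℝ) +
      evalR (W 1) x • EuclideanSpace.single (1 : Fin 3) (1 : ℝ)) := i0.add i1
  unfold w tabField
  rw [integral_add i01 i2, integral_add i0 i1, integral_smul_const, integral_smul_const,
    integral_smul_const, integral_evalR, integral_evalR, integral_evalR, coeff0_W, coeff0_W, coeff0_W]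
  simp [GQ.zero]

/-! ## 4. The strain matrix: symmetric, trace free, singular ⇒ `λ₂ ≡ 0` -/

/-- Table of the strain entry `Sᵢⱼ/(2π) = ((∂ⱼw)ᵢ + (∂ᵢw)ⱼ)/(4π)`. [ours; bookkeeping] -/
def ST (i j : Fin 3) : TP := smul (1 / 2) (TP.D j (W i) ++ TP.D i (W j))

/-- **Strain entries in table form**: `Sᵢⱼ(x) = 2π · evalR (ST i j) x`. [ours] -/
theorem strain_entry (x : UnitAddTorus (Fin 3)) (i j : Fin 3) :
    (Torus.partialDeriv j w x i + Torus.partialDeriv i w x j) / 2 = 2 * Real.pi * evalR (ST i j) x := by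
  simp only [partialDeriv_w, ST, evalR_smul, evalR_append]
  push_cast
  ring

/-- Atoms are real: `eval (ST i j) = evalR (ST i j)`. [ours; bookkeeping] -/
theorem eval_ST (i j : Fin 3) (x : UnitAddTorus (Fin 3)) :
    eval (ST i j) x = ((evalR (ST i j) x : ℝ) : ℂ) :=
  ((((isReal_W i).D j).append ((isReal_W j).D i)).smul _).eval_eq x

/-- The strain matrix of `w` at `x` (the matrix of the C3b row). [ours; bookkeeping] -/
def strainM (x : UnitAddTorus (Fin 3)) : Matrix (Fin 3) (Fin 3) ℝ :=
  Matrix.of fun i j => (Torus.partialDeriv j w x i + Torus.partialDeriv i w x j) / 2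

/-- Strain matrix entries in table form. [ours; bookkeeping] -/
theorem strainM_apply (x : UnitAddTorus (Fin 3)) (i j : Fin 3) :
    strainM x i j = 2 * Real.pi * evalR (ST i j) x := by
  rw [strainM, Matrix.of_apply, strain_entry]

/-- The strain matrix is symmetric. [ours; bookkeeping] -/
theorem strainM_isSymm (x : UnitAddTorus (Fin 3)) : (strainM x).IsSymm := by
  ext i j
  simp only [strainM, Matrix.transpose_apply, Matrix.of_apply]
  ring

/-- The strain matrix is trace free (`tr S = div w = 0`). [ours] -/
theorem strainM_trace (x : UnitAddTorus (Fin 3)) : (strainM x).trace = 0 := by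
  have hdiv := isDivFree_w x
  rw [divergence_eq_sum_partialDeriv_apply isContDiff_w, Fin.sum_univ_three] at hdiv
  rw [Matrix.trace, Fin.sum_univ_three]
  simp only [Matrix.diag, strainM, Matrix.of_apply]
  linarith

/-- Table of `det S / (2π)³`. [ours; bookkeeping] -/
def detT : TP :=
  mulC (ST 0 0) (mulC (ST 1 1) (ST 2 2) ++ neg (mulC (ST 1 2) (ST 2 1))) ++
    neg (mulC (ST 0 1) (mulC (ST 1 0) (ST 2 2) ++ neg (mulC (ST 1 2) (ST 2 0)))) ++
    mulC (ST 0 2) (mulC (ST 1 0) (ST 2 1) ++ neg (mulC (ST 1 1) (ST 2 0)))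

/-- The determinant table collects to the empty table. [ours; by `decide`] -/
theorem collect_detT : collect detT = [] := by decide +kernel

/-- **The strain matrix of `w` is singular everywhere.** [ours] -/
theorem strainM_det (x : UnitAddTorus (Fin 3)) : (strainM x).det = 0 := by
  have h : eval detT x = 0 := by rw [← eval_collect, collect_detT, eval_nil]
  have e : ((strainM x).det : ℂ) = (2 * Real.pi) ^ 3 * eval detT x := by
    rw [Matrix.det_fin_three]
    simp only [strainM_apply]
    push_cast
    simp only [← eval_ST, detT, eval_append, eval_neg, eval_mulC]
    ring
  rw [h, mul_zero] at e
  exact_mod_cast e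

/-- **`λ₂(S(w)) = 0` everywhere** (row convention: every Hermitian structure on the strain matrix has
middle eigenvalue `≤ 0`, so `Λ = 0` is an admissible C3b multiplier). [ours] -/
theorem middle_w_nonpos : ∀ x : UnitAddTorus (Fin 3), ∀ hx : (Matrix.of fun i j =>
    (Torus.partialDeriv j w x i + Torus.partialDeriv i w x j) / 2).IsHermitian,
    hx.eigenvalues₀ (Fin.cast (Fintype.card_fin 3).symm 1) ≤ 0 := by
  intro x hx
  exact (MiddleEigen.middle_eq_zero_of_det_eq_zero (Fintype.card_fin 3) (strainM x)
    (strainM_isSymm x) (strainM_trace x) (strainM_det x)).le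

/-! ## 5. The vortex-stretching density vanishes identically -/

/-- Table of `∑ₖ (∂ᵢw)ₖ(∂ₖw)ⱼ / (2π)²`. [ours; bookkeeping] -/
def NLT (i j : Fin 3) : TP := collect (sum3 fun k => mulC (TP.D i (W k)) (TP.D k (W j)))

/-- `∑ₖ (∂ᵢw)ₖ(∂ₖw)ⱼ = (2π)² · evalR (NLT i j)` (complex form). [ours; bookkeeping] -/
theorem gradSq_entry (i j : Fin 3) (x : UnitAddTorus (Fin 3)) :
    ((∑ k, Torus.partialDeriv i w x k * Torus.partialDeriv k w x j : ℝ) : ℂ) =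
      (2 * Real.pi) ^ 2 * eval (NLT i j) x := by
  rw [Fin.sum_univ_three]
  simp only [partialDeriv_w]
  push_cast
  simp only [← eval_DW, NLT, eval_collect, eval_sum3, eval_mulC]
  ring

/-- Table of `σ(w)/(2π)³`, `σ = −∑ᵢⱼ ((∂ᵢw)ⱼ − (∂ⱼw)ᵢ) ∑ₖ (∂ᵢw)ₖ(∂ₖw)ⱼ`. [ours; bookkeeping] -/
def sigmaT : TP :=
  neg (sum3 fun i => sum3 fun j => mulC (TP.D i (W j) ++ neg (TP.D j (W i))) (NLT i j))

/-- The stretching table collects to the empty table. [ours; by `decide`] -/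
theorem collect_sigmaT : collect sigmaT = [] := by decide +kernel

/-- **`σ(w) = 0` everywhere** (so `A = 0` is an admissible C3a multiplier). [ours] -/
theorem stretchingDensity_w (x : UnitAddTorus (Fin 3)) : torusStretchingDensity w x = 0 := by
  have h : eval sigmaT x = 0 := by rw [← eval_collect, collect_sigmaT, eval_nil]
  have e : ((torusStretchingDensity w x : ℝ) : ℂ) = (2 * Real.pi) ^ 3 * eval sigmaT x := by
    simp only [torusStretchingDensity, torusVorticityTensor, Fin.sum_univ_three, partialDeriv_w]
    push_cast
    simp only [← eval_DW, sigmaT, NLT, eval_neg, eval_sum3, eval_append, eval_mulC, eval_collect]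
    ring
  rw [h, mul_zero] at e
  exact_mod_cast e

/-- Hence `σ(w) ≤ 0` pointwise (the hypothesis of the C3a door). [ours; bookkeeping] -/
theorem stretchingDensity_w_nonpos (x : UnitAddTorus (Fin 3)) : torusStretchingDensity w x ≤ 0 :=
  (stretchingDensity_w x).le

/-! ## 6. The pressure of `w` in table form -/

/-- Table of `tr(∇w)²/(2π)² = ∑ᵢⱼ (∂ᵢw)ⱼ(∂ⱼw)ᵢ/(2π)²`. [ours; bookkeeping] -/
def Q : TP := collect (sum3 fun i => sum3 fun j => mulC (TP.D i (W j)) (TP.D j (W i)))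

/-- `Q` is real. [ours; bookkeeping] -/
theorem isReal_Q : IsReal Q :=
  (IsReal.sum3 fun i => IsReal.sum3 fun j => ((isReal_W j).D i).mulC ((isReal_W i).D j)).collect

/-- **`tr(∇w)² = (2π)² · evalR Q`.** [ours] -/
theorem gradSqTrace_w (x : UnitAddTorus (Fin 3)) : gradSqTrace w x = (2 * Real.pi) ^ 2 * evalR Q x := by
  have e : ((gradSqTrace w x : ℝ) : ℂ) = (2 * Real.pi) ^ 2 * eval Q x := by
    simp only [gradSqTrace, Fin.sum_univ_three, partialDeriv_w]
    push_cast
    simp only [← eval_DW, Q, eval_collect, eval_sum3, eval_mulC]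
    ring
  rw [isReal_Q.eval_eq x] at e
  exact_mod_cast e

/-- The pressure table `P = linv (−Q)` (`π_w = Δ⁻¹(−tr(∇w)²)`). [ours; bookkeeping] -/
def P : TP := linv (neg Q)

/-- `−Q` has no zero mode. [ours; by `decide`] -/
theorem noZeroMode_negQ : NoZeroMode (neg Q) := by decide +kernel

/-- `P` is real. [ours; bookkeeping] -/
theorem isReal_P : IsReal P := isReal_Q.neg.linv noZeroMode_negQ

/-- **The pressure of `w` in table form: `pressureOf w = evalR P`.** [ours] -/
theorem pressureOf_w : pressureOf w = evalR P := by
  unfold pressureOf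
  have h1 : (fun x => -gradSqTrace w x) = ((2 * Real.pi) ^ 2) • evalR (neg Q) := by
    funext x; simp [gradSqTrace_w, evalR_neg]
  rw [h1, invLaplacian_const_smul _ _ (isSmooth_evalR _), invLaplacian_evalR noZeroMode_negQ]
  funext x
  have hpi : ((2 * Real.pi) ^ 2 : ℝ) ≠ 0 := by positivity
  simp only [Pi.smul_apply, smul_eq_mul, P]
  field_simp

/-- **Pressure Hessian**: `∂ᵢ∂ⱼπ_w(x) = (2π)² · evalR (D i (D j P)) x`. [ours] -/
theorem hessian_pressureOf_w (i j : Fin 3) (x : UnitAddTorus (Fin 3)) :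
    Torus.partialDeriv i (Torus.partialDeriv j (pressureOf w)) x =
      (2 * Real.pi) ^ 2 * evalR (TP.D i (TP.D j P)) x := by
  rw [pressureOf_w, partialDeriv_evalR']
  have h : (fun x => 2 * Real.pi * evalR (TP.D j P) x) = (2 * Real.pi) • evalR (TP.D j P) := by
    funext y; simp
  rw [h, partialDeriv_const_smul ((isSmooth_evalR _).isContDiff (by simp)), Pi.smul_apply, smul_eq_mul,
    partialDeriv_evalR]
  ring

/-- Atoms are real: `eval P = evalR P`, `eval (D i (D j P)) = evalR (…)`, `eval (D j P) = evalR (…)`.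
[ours; bookkeeping] -/
theorem eval_P (x : UnitAddTorus (Fin 3)) : eval P x = ((evalR P x : ℝ) : ℂ) := isReal_P.eval_eq x

/-- See `eval_P`. [ours; bookkeeping] -/
theorem eval_DDP (i j : Fin 3) (x : UnitAddTorus (Fin 3)) :
    eval (TP.D i (TP.D j P)) x = ((evalR (TP.D i (TP.D j P)) x : ℝ) : ℂ) :=
  ((isReal_P.D j).D i).eval_eq x

end PlanarShadow

end Summit.NavierStokesRegularity.FunctionalMining

end
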